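import Summits.Ventures.CertifiedManyBodySolver.Downfold.EmeryChargeTransferSlopeLaw
import Summits.Ventures.CertifiedManyBodySolver.Downfold.EmeryFermiEnergyExistsAll
import HarnessLib

/-!
# THE FERMI-ENERGY SLOPE LAW OVER A Δ-INTERVAL AT FIXED FILLING: `ε_F(Δ₂; ν) + κ(Δ₂ − Δ₁) ≤ ε_F(Δ₁; ν)` for every rate `κ < 1 − w̄`, `w̄` = the axis-weight ceiling at the
# interval's bottom Fermi energy — the negative UPPER bound on `dε_F/dΔ` that `EmeryChargeTransferLipschitz` (`−1 ≤ slope ≤ 0`) lacked (INFL-3to1-B §B.90 (i))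

Venture CertifiedManyBodySolver, cell `pub/hubbard-downfold` (stage S1; INFLATION-RULES-3to1-B §B.83, §B.90 (h)–(i)), seat hubbard-downfold-mod-4 (technique B, g38); namespace
`Summit.Ventures.CertifiedManyBodySolver.Downfold.Emery`. Sequel of `EmeryChargeTransferSlopeLaw` (pointwise law `abBand_slope_law`, shell transfer
`fermiEnergyOf_shift_le_sub_of_shell`) and `EmeryOrbitalWeightAxisBox` (`dWeightAxisCF` and its levers). Everything PROVED (0 sorry; a second telescoping, over the filling:
the Δ-interval is cut into steps so small that the energy shell `(ε_F − κh, ε_F]` of each step stays above `E_low`, where the axis ceiling bounds every state's Cu-d weight).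
WHAT THIS IS NOT: a statement about any material; `U = 0` one-body kinematics of the σ (d–pₓ–p_y + t_pp + t_pp′) model.

THE STATEMENT (`fermiEnergyOf_slope_law`). Fixed `(a, b, c)` with `a ≠ 0`, `0 ≤ c ≤ b`, `b > 0`; `0 < Δ₁ ≤ Δ₂`; filling `0 < ν < 1`; numbers `0 < E_low < E_l ≤ ε_F(Δ₂; ν)` and
`ε_F(Δ₁; ν) ≤ E_h` with `cE_h < a²` and the axis energy-lever margin `c(Δ₁(E_low + E_h) + E_lowE_h) ≤ a²Δ₁`, `c(E_low + E_h) ≤ a²`; `w̄ := dWeightAxisCF(Δ₂, a, c; E_low)`,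
`κ ≥ 0`, `κ + w̄ < 1` ⇒ **`ε_F(Δ₂; ν) + κ(Δ₂ − Δ₁) ≤ ε_F(Δ₁; ν)`**. With the g36/g37 Fermi-energy brackets and the §B.90 (e) ceilings every hypothesis is a `norm_num` line:
the energy channel of the fixed-FILLING antinodal lever (successor device of §B.90 (h)) — e.g. on the (K) cuprate boxes `w̄ ≲ 0.8` gives `κ ≈ 0.2`.

Sources: three-band model [HybertsenSchluterChristensen1989, Eq. (1)]; Hellmann–Feynman / first-order perturbation theory [folklore]; [folklore] analysis.
-/

noncomputable section

namespace Summit.Ventures.CertifiedManyBodySolver.Downfold.Emery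

open Real Set

/-- Telescoping engine for the Fermi energy: per-step drops `κh` add up. [folklore] -/
theorem fermiEnergyOf_steps_le {Δ a b c ν h κ : ℝ} {m : ℕ}
    (hstep : ∀ i : ℕ, i < m → fermiEnergyOf (Δ + (i + 1) * h) a b c ν + κ * h ≤ fermiEnergyOf (Δ + i * h) a b c ν) :
    fermiEnergyOf (Δ + m * h) a b c ν + κ * (m * h) ≤ fermiEnergyOf Δ a b c ν := by
  induction m with
  | zero => simp
  | succ m ih =>
    have h1 := ih (fun i hi => hstep i (Nat.lt_succ_of_lt hi))
    have h2 := hstep m (Nat.lt_succ_self m)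
    push_cast at h1 h2 ⊢
    linarith

/-- **THE FERMI-ENERGY SLOPE LAW OVER A Δ-INTERVAL** (see the module docstring for the hypotheses). [folklore] -/
theorem fermiEnergyOf_slope_law {Δ₁ Δ₂ a b c ν κ Elow El Eh : ℝ} (hΔ₁ : 0 < Δ₁) (hΔ : Δ₁ ≤ Δ₂) (ha : a ≠ 0) (hc : 0 ≤ c) (hcb : c ≤ b) (hb : 0 < b)
    (hν0 : 0 < ν) (hν1 : ν < 1) (hElow : 0 < Elow) (hEl : Elow < El) (hElF : El ≤ fermiEnergyOf Δ₂ a b c ν) (hEhF : fermiEnergyOf Δ₁ a b c ν ≤ Eh)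
    (hm : c * Eh < a ^ 2) (hlev : c * (Δ₁ * (Elow + Eh) + Elow * Eh) ≤ a ^ 2 * Δ₁) (hsl : c * (Elow + Eh) ≤ a ^ 2)
    (hκ0 : 0 ≤ κ) (hκ : κ + dWeightAxisCF Δ₂ a c Elow < 1) :
    fermiEnergyOf Δ₂ a b c ν + κ * (Δ₂ - Δ₁) ≤ fermiEnergyOf Δ₁ a b c ν := by
  have hb0 : 0 ≤ b := hc.trans hcb
  set W := dWeightAxisCF Δ₂ a c Elow with hW
  have hex : ∀ {D : ℝ}, 0 < D → ∃ ε : ℝ, abFilling D a b c ε = ν := fun hD =>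
    let ⟨ε, _, h⟩ := exists_fermiEnergy_of_mem_Ioo hD ha hc hb0 hν0 hν1; ⟨ε, h⟩
  -- ε_F is non-increasing in Δ: every ε_F(Δ') with Δ' ∈ [Δ₁, Δ₂] lies in [El, Eh]
  have hFmono : ∀ {D D' : ℝ}, Δ₁ ≤ D → D ≤ D' → fermiEnergyOf D' a b c ν ≤ fermiEnergyOf D a b c ν := by
    intro D D' hD hDD'
    have hD0 : 0 < D := lt_of_lt_of_le hΔ₁ hD
    have := fermiEnergyOf_shift_le (Δ := D) (a := a) (b := b) (c := c) (δ := D' - D) (ν := ν) hD0 ha hc hb0 (by linarith) hν0 hν1 (hex hD0) (hex (by linarith))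
    rw [show D + (D' - D) = D' by ring] at this; exact this
  -- choose the step: (1 + κ)h ≤ El − Elow
  obtain ⟨m, hmgt⟩ := exists_nat_gt ((1 + κ) * (Δ₂ - Δ₁) / (El - Elow))
  have hgap : 0 < El - Elow := by linarith
  have hm0 : 0 < (m : ℝ) := lt_of_le_of_lt (div_nonneg (mul_nonneg (by linarith) (by linarith)) hgap.le) hmgt
  set h := (Δ₂ - Δ₁) / m with hh
  have hh0 : 0 ≤ h := div_nonneg (by linarith) hm0.le
  have hmh : (m : ℝ) * h = Δ₂ - Δ₁ := by rw [hh]; field_simp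
  have hsmall : (1 + κ) * h ≤ El - Elow := by
    have : (1 + κ) * (Δ₂ - Δ₁) < m * (El - Elow) := by have := (div_lt_iff₀ hgap).1 hmgt; linarith
    rw [hh, show (1 + κ) * ((Δ₂ - Δ₁) / m) = (1 + κ) * (Δ₂ - Δ₁) / m by ring, div_le_iff₀ hm0]
    linarith
  -- the step
  have hstep : ∀ i : ℕ, i < m → fermiEnergyOf (Δ₁ + (i + 1) * h) a b c ν + κ * h ≤ fermiEnergyOf (Δ₁ + i * h) a b c ν := by
    intro i hi
    have hi1 : ((i : ℝ) + 1) * h ≤ Δ₂ - Δ₁ := by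
      have : ((i : ℝ) + 1) ≤ m := by exact_mod_cast hi
      calc ((i : ℝ) + 1) * h ≤ m * h := mul_le_mul_of_nonneg_right this hh0
        _ = Δ₂ - Δ₁ := hmh
    have hi0 : 0 ≤ (i : ℝ) * h := mul_nonneg (Nat.cast_nonneg i) hh0
    set D := Δ₁ + i * h with hD
    have hD1 : Δ₁ ≤ D := by linarith
    have hD2 : D + h ≤ Δ₂ := by
      have e : ((i : ℝ) + 1) * h = i * h + h := by ring
      rw [hD]; linarith
    have hDpos : 0 < D := lt_of_lt_of_le hΔ₁ hD1
    rw [show Δ₁ + (↑i + 1) * h = D + h by rw [hD]; ring]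
    -- ε_F(D) ∈ [El, Eh]
    have hFD_lo : El ≤ fermiEnergyOf D a b c ν := hElF.trans (hFmono hD1 (by linarith))
    have hFD_hi : fermiEnergyOf D a b c ν ≤ Eh := (hFmono le_rfl hD1).trans hEhF
    have eκ : (1 + κ) * h = h + κ * h := by ring
    refine fermiEnergyOf_shift_le_sub_of_shell hDpos ha hc hb0 hh0 hν0 hν1 (by linarith) ?_
    intro k hk hklo hkhi
    -- the state k of row D in the shell: apply the pointwise slope law with w̄ = W
    have hx : halfSq k.1 ∈ Icc (0 : ℝ) 1 := ⟨halfSq_nonneg _, halfSq_le_one _⟩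
    have hy : halfSq k.2 ∈ Icc (0 : ℝ) 1 := ⟨halfSq_nonneg _, halfSq_le_one _⟩
    set x := halfSq k.1
    set y := halfSq k.2
    -- energies along [D, D + h] stay in [Elow, Eh]
    have hEfin_lo : Elow ≤ abBand (D + h) a b c x y := by
      have h1 := abBand_sub_le_abBand_shift (Δ := D) (a := a) (b := b) (c := c) (x := x) (y := y) (δ := h) hDpos.le hc hb0 hx.1 hy.1 hh0
      linarith
    have hEfin_pos : 0 < abBand (D + h) a b c x y := lt_of_lt_of_le hElow hEfin_lo
    refine abBand_slope_law hDpos ha hc hcb hx hy hh0 hκ0 hκ hEfin_pos ?_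
    intro t ht
    set Et := abBand (D + t) a b c x y with hEt
    have hEt_lo : Elow ≤ Et := by
      have := abBand_shift_le_abBand (Δ := D + t) (a := a) (b := b) (c := c) (x := x) (y := y) (δ := h - t) (by linarith [ht.1]) ha hc hb0 hx.1 hy.1 (by linarith [ht.2])
      rw [show D + t + (h - t) = D + h by ring] at this
      exact hEfin_lo.trans this
    have hEt_hi : Et ≤ Eh := by
      have := abBand_shift_le_abBand (Δ := D) (a := a) (b := b) (c := c) (x := x) (y := y) (δ := t) hDpos ha hc hb0 hx.1 hy.1 ht.1
      exact (this.trans hkhi).trans hFD_hi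
    have hEt_pos : 0 < Et := lt_of_lt_of_le hElow hEt_lo
    have hmt : c * Et < a ^ 2 := lt_of_le_of_lt (mul_le_mul_of_nonneg_left hEt_hi hc) hm
    -- w ≤ w_axis(D + t; Et) = CF(D + t, a, c; Et) ≤ CF(Δ₂, a, c; Et) ≤ CF(Δ₂, a, c; Elow) = W
    have hw := (dWeight_mem_Icc_node_axis (by linarith [ht.1]) hc hcb hb ha hEt_pos hmt hx hy (charCubic_abBand (D + t) a b c x y)).2.2
    rw [dWeightAxis_eq_CF (by linarith [ht.1]) hEt_pos ha hmt] at hw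
    have h2 : dWeightAxisCF (D + t) a c Et ≤ dWeightAxisCF Δ₂ a c Et :=
      dWeightAxisCF_mono_Delta (by linarith [ht.1]) (by linarith [ht.2]) hEt_pos.le hc hmt
    have h3 : dWeightAxisCF Δ₂ a c Et ≤ dWeightAxisCF Δ₂ a c Elow := by
      refine dWeightAxisCF_anti_eps (lt_of_lt_of_le hΔ₁ hΔ) hc hElow.le hEt_lo hmt ?_
      -- c(Δ₂(Elow + Et) + Elow·Et) ≤ a²Δ₂ from the margin at Δ₁ and the slope condition
      have h4 : c * (Δ₂ * (Elow + Et) + Elow * Et) ≤ c * (Δ₂ * (Elow + Eh) + Elow * Eh) := by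
        apply mul_le_mul_of_nonneg_left _ hc
        have e4 : Δ₂ * (Elow + Eh) + Elow * Eh - (Δ₂ * (Elow + Et) + Elow * Et) = (Eh - Et) * (Δ₂ + Elow) := by ring
        have : 0 ≤ (Eh - Et) * (Δ₂ + Elow) := mul_nonneg (by linarith) (by linarith [lt_of_lt_of_le hΔ₁ hΔ])
        linarith
      have e5 : c * (Δ₂ * (Elow + Eh) + Elow * Eh) = c * (Δ₁ * (Elow + Eh) + Elow * Eh) + (Δ₂ - Δ₁) * (c * (Elow + Eh)) := by ring
      have h6 := mul_le_mul_of_nonneg_left hsl (sub_nonneg.2 hΔ)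
      nlinarith
    exact hw.trans (h2.trans h3)
  have := fermiEnergyOf_steps_le (Δ := Δ₁) (a := a) (b := b) (c := c) (ν := ν) (κ := κ) hstep
  rw [hmh, show Δ₁ + (Δ₂ - Δ₁) = Δ₂ by ring] at this
  exact this

end Summit.Ventures.CertifiedManyBodySolver.Downfold.Emery
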